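import Summits.QuantumFields.YangMills.Theorems.BalabanUVNodesN26AtTheta13OfThm1CStubD4TowerFlat

/-!
# DAG node N26 ∕ row (D4) — CRUX K2⁗ `EndpointGivenBR13Sep` (stmt-QuantumFields-20291; plan g67 KEY-18 ∕ dag-lead WORDS-140: the re-key of K2‴ `EndpointGivenBR13`
# 19911, now ASIDE, under the token map `Provisos₁₃ ↦ Provisos₁₃Sep`, `datumOfRecord₁₃ ↦ datumOfRecord₁₃Sep`) — THE REGISTERED (D4) STUB `stub_d4AtSlopeCont13 :
# D4AtSlopeOfD1Record13` (‴ skeleton `K2Skeleton13.lean` 3f282f2ad62aefca; ⁗ twin `D67-REV18/K2Skeleton13Sep.lean` f65d6d28302ea0ea REGISTERED on 20291 — the same text but for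
# the antecedent `hP : θ.Provisos₁₃Sep F 2`, UNUSED by the (D4) side): ITS BODY
# `∀ (Lc, Js, Nc) pinned on the record's β⁰ with the (D1) residue, ∃ γ₁ ∈ ]0, θ.γ], AtSlopeCont (split₁₃ θ) γ₁ (stepBal Nc Lc)` AT ONE MEMBER `ε₂₉(d₀)` OF NODE 00's
# COMPATIBLE [15]-KEYED FAMILY θ₁₅ᶜ = `theta13OfThm1C F N ε₀ ε₂₉ B₃ a₀ a₁`, WITH NODE D SUPPLIED AND THE β-SIDE ROWS PAID, UNDER ONE DISPLAYED (D1)-SIDE LETTER —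
# a positive FLOOR `d₀` of the (D1) slopes along the family (dag-n26-c g8's `hd₀`)

Cell pub-balaban, β-function sub-cell, BINDER row (D4) OWNER lineage `b2b-balaban-beta-an4` (gen 128, second module, filed `--supports stmt-QuantumFields-20291` per WORDS-140; memo
`HOME/b2b-balaban-beta-an4/FLAT-LETTERS-LOCATED.md` §39).  Context.  (E) = `…N26AtTheta13OfThm1CStubD4TowerFlat` (this gen, p500978, booked under 19911 before the KEY line) read the registered stub at θ₁₅ᶜ in
this row's NODE-D-SUPPLIED currency ((C) p492935 ∕ (D) p494008 — NE9's flat tower operator builds the (190) datum on the members' tori) with dag-n26-c g7's β-side rows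
(p497784 `condsL_faithful_theta13OfThm1C_of_eps_le`, ★ `exists_eps29_rows_theta13OfThm1C`) plugged in by name: §1 the stub's CONSEQUENT at `(F, θ₁₅ᶜ, Lc, Nc)` with the
seam row `ε₂₉·K_rem,L ≤ stepBal Nc Lc` displayed, §2 the (D4) product at a FREE slope `s` with N1 and the seam row CONSUMED.  What §2 left open (its HONEST clause; dag-ref-D
READ-171; dag-n26-c g8 INTENT-1 pub-ymgap l.16709): under stub 1 the slope is NOT free — at a member θ it is the (D1) datum's `stepBal Nc Lc` (the member's one-loop Cesàro
drift, ONE number per θ by the tree's slope rigidity `Gaps.D1Residue.oneLoopDrift_slope_unique`), and ε₂₉ must be chosen BEFORE the datum.  The one letter that closes the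
circle is a positive FLOOR `d₀` of the data's slopes along the admissible range of the family — print: `β⁰_{k+1}` does not read the (2.9) threshold ([I] (2.12)–(2.13)
p. 268), so the drift is ε₂₉-blind and any single positive drift is a floor; in the tree `beta0OfMerged` reads χ(ε₂₉) (`Node00/BetaOfRecord.lean` :192), so the floor is a
HYPOTHESIS — the (D1) lane's ∕ N25's sentence in Cesàro form (n26-c g8's `hd₀`), displayed here VERBATIM in K2‴'s β-tokens.

WHAT THIS FILE PROVES (0 `def`, 0 `sorry`; ONE application of p492935 clause (ii) with p497784 §1c at `s := d₀`):
★ `exists_eps29_d4AtSlopeOfD1Record13_at_theta13OfThm1C_of_drift_towerFlat (hε hB ha₀ ha₁)` — for NE9's structure data and thresholds `(δs, Cs)`, tower weights, cube side ∕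
geometry ∕ numerics on `q`, a box `γ₀`, channel, (4.4)-radius, residual `c₀`, and a drift floor `d₀ > 0` with
`hdrift : ∀ e, 0 < e → 4e < ε₀ → θ₁₅ᶜ(e).Admissible → ∀ (Lc, Js, Nc), [pin of `β⁰(θ₁₅ᶜ(e))` on `secondMoment (TbalOf Lc Js ·) 0 1`] → D1Residue.Residue Lc Js Nc 0 1 →
d₀ ≤ stepBal Nc Lc` (= dag-n26-c g8's `hd₀` of p502604 `exists_eps29_rows_seam_at_data_theta13OfThm1C_of_drift_ge`, VERBATIM),
THERE IS a member `ε₂₉ > 0` (`4ε₂₉ < ε₀`, θ₁₅ᶜ ADMISSIBLE, `ZtUnity`) such that — from the Stage-12 [B13] family of record at the faithful letters with N10's leaf + letters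
law, the (1.22) identification at the ₁₃ merged β, the run sequences ∕ laws ∕ `Restr` (NODE O ∕ 00 ∕ A), N3, any display ∕ witness, the (4.4) seams from the tower's fine bond
fields (NODE B), the (1.7) data with `hconv` on the explicit flat (4.35) vectors (NODE E), `0 < γ₀`, `Valid`, (C-leaf) ALONE — FOR EVERY (D1) DATUM `(Lc, Js, Nc)` PINNED ON
THE MEMBER's `β⁰` WITH ITS RESIDUE: `∃ γ₁, 0 < γ₁ ∧ γ₁ ≤ θ₁₅ᶜ.γ ∧ AtSlopeCont (split₁₃ θ₁₅ᶜ) γ₁ (stepBal Nc Lc)`.  At `N := 2` the part after `∃ ε₂₉ …` IS the BODY of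
`K2Skeleton13.D4AtSlopeOfD1Record13` at `θ := θ₁₅ᶜ(ε₂₉)` (its `hP`, `Admissible` antecedents aside — `Admissible` is DELIVERED), MODULO the displayed NODE O ∕ B ∕ E inputs +
N3 + `Valid` + (C-leaf) and the ONE (D1)-side letter `hdrift`: the N1 row AND the seam row are PAID (ε₂₉ chosen after `M, α₂, q.B₃, c₀, d₀`, BEFORE the datum:
`ε₂₉·K_rem,L ≤ d₀ ≤ stepBal Nc Lc`), NODE D is SUPPLIED.  The NODE-D-SUPPLIED face of dag-n26-c g8's announced §4 (`…N26SlopeOfRecord13`, rows + seam at every datum's own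
slope under `hd₀`) composed with the (D4) product — typed independently over p497784 §1c (their lemma, when landed, gives the same member BY NAME).

HONEST FRAMING.  A REDUCTION at ONE member of the K0‴ candidate family — NOT a proof of `stub_d4AtSlopeCont13` (whose `∀ θ` ranges over every admissible tuple, including
members above the threshold where the (D4) road does not reach it); nothing of Bałaban's objects asserted; `hdrift` is a HYPOTHESIS (instance 0∕1 — at the pinned live
witness no (D1) datum is exhibited either); NODE D on the MODEL class (zero background, one-domain tower, value line, one source direction); (D4) INSTANCE 0∕1, D4 DISCHARGE
NO DATE; K2‴ ∕ K2⁗ NOT proved; N25 ∕ N26 NOT discharged; counts unmoved.  One finite four-torus programme at fixed ε per run — NOT the continuum limit, NOT ℝ⁴, NOT infinite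
volume, NOT OS, NOT a mass gap, NOT Clay.  No `instance`, no `notation`, no `axiom`.
Sources (context): [I] = [Balaban1987RG1] CMP **109** (1987): Thm 2 p. 259, (1.3) p. 260, (1.7) p. 261, (1.18) p. 263, (1.20)–(1.22) p. 264, (2.9) p. 266,
(2.12)–(2.13) p. 268, (4.4) p. 281, (4.35) p. 290, (5.1) p. 292; [II] = [Balaban1988RG2Cluster] CMP **116** (1988): Lemma 3 (2.38) p. 20, p. 21; [III] =
[Balaban1988Convergent] CMP **119** (1988): (2.10) p. 256; [15] = [Balaban1985Variational] CMP **102** (1985): Thm 1 p. 279, (190) p. 308.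
-/

noncomputable section

open scoped Matrix.Norms.L2Operator InnerProductSpace ComplexConjugate

namespace Summit.QuantumFields.YangMills.Theorems.BalabanUVNodesN26AtTheta13OfThm1CStubD4OfDriftTowerFlat

open Literature.MathematicalPhysics.QuantumFieldTheory.Balaban1983to89
open Literature.MathematicalPhysics.QuantumFieldTheory.Balaban1983to89.FlowStep
open Literature.MathematicalPhysics.QuantumFieldTheory.Balaban1983to89.T4Continuum (T4Family)
open Literature.MathematicalPhysics.QuantumFieldTheory.Balaban1983to89.Node00
open Literature.MathematicalPhysics.QuantumFieldTheory.Balaban1983to89.B13ScaleTransfer (Pt)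
open Literature.MathematicalPhysics.QuantumFieldTheory.Balaban1983to89.TreeLengthTorus (TPt TDom proj)
open Literature.MathematicalPhysics.QuantumFieldTheory.Balaban1983to89.B4Sect5Torus (TSite)
open Literature.MathematicalPhysics.QuantumFieldTheory.Balaban1983to89.B12Decay510 (mixedDeriv)
open Literature.MathematicalPhysics.QuantumFieldTheory.Balaban1983to89.B12Decay510Torus (tcubeOf)
open Literature.MathematicalPhysics.QuantumFieldTheory.Balaban1983to89.B9SectCLatticeCarrier (Bond bpos)
open Literature.MathematicalPhysics.QuantumFieldTheory.Balaban1983to89.B9Eq311L2Pairing (WL2)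
open Literature.MathematicalPhysics.QuantumFieldTheory.Balaban1983to89.B9Eq315QTower (towerP UlevOf)
open Literature.MathematicalPhysics.QuantumFieldTheory.Balaban1983to89.B9Eq315QTorus (perCfg cornerSite)
open Literature.MathematicalPhysics.QuantumFieldTheory.Balaban1983to89.B9Eq319QprimeTorus (blockCoord)
open Literature.MathematicalPhysics.QuantumFieldTheory.Balaban1983to89.B9Eq316TowerFlatIsOneStep (siteCast towerP_eq_fineP_pow)
open Literature.MathematicalPhysics.QuantumFieldTheory.Balaban1983to89.B7Prop1Explicit (U1 Wcx boxVec)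
open Literature.MathematicalPhysics.QuantumFieldTheory.Balaban1983to89.B7Prop2Explicit (c2')
open Literature.MathematicalPhysics.QuantumFieldTheory.Balaban1983to89.B11Eq103H1Complex (BondL2K)
open Literature.MathematicalPhysics.QuantumFieldTheory.Balaban1983to89.B9Eq326OperatorTower (laplaceAk H1k)
open Literature.MathematicalPhysics.QuantumFieldTheory.Balaban1983to89.Beta.RemainderChainLattice
open Literature.MathematicalPhysics.QuantumFieldTheory.Balaban1983to89.Beta.RemainderLimitTorus (LDom limKernel tproj)
open Literature.MathematicalPhysics.QuantumFieldTheory.Balaban1983to89.Beta.RemainderDecay190 (Consts190 Data190)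
open Literature.MathematicalPhysics.QuantumFieldTheory.Balaban1983to89.Beta.RemainderDecay190HoloChain (ChainTFac190H)
open Literature.MathematicalPhysics.QuantumFieldTheory.Balaban1983to89.Beta.RemainderWOfRecordB13 (SpLaw Law213 NOfLayers)
open Summit.QuantumFields.BalabanUV.Gaps
open Summit.QuantumFields.BalabanUV.Gaps.BetaContFromD4Chain
open Summit.QuantumFields.YangMills.Theorems.BalabanUVNodesN26AtRecord13FamilyTowerFlat
  (exists_chainTFac190H_betaOfRecord₁₃_of_family_towerFlat)
open Literature.MathematicalPhysics.QuantumFieldTheory.Balaban1983to89.B12TreeDecay (K₀)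
open Summit.QuantumFields.YangMills.Theorems.BalabanUVNodesN26AtRecord13StubD4TowerFlat
  (d4AtSlopeOfD1Record13_at_of_family_towerFlat)
open Summit.QuantumFields.YangMills.Theorems.BalabanUVNodesN26AtTheta13OfThm1C
  (condsL_faithful_theta13OfThm1C_of_eps_le exists_eps29_rows_theta13OfThm1C)
open Metric Filter Topology
open Literature.MathematicalPhysics.QuantumFieldTheory.Balaban1983to89.Beta.OneStepKernelFamily (TbalOf)
open Literature.MathematicalPhysics.QuantumFieldTheory.Balaban1983to89.Beta.OneStepResolventKernel (JetData)

variable (F : T4Family) (N : ℕ) [NeZero N]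

section AtTheta15COfDrift


-- NE9's tower structure data ([5] §3 ∕ [15]: block size `L ≥ 3`, the C⋆-algebra `𝔸`, its Hilbert model `W ≃ 𝔸`, the trace `τ`, `a, a′, ρ_w, A_Q`; the letters `a, a′` are `aQ, aQ'` here — K0a's witness owns the names `a₀, a₁`)
variable (L : ℕ) [NeZero L] (hL : 1 ≤ L) (hL3 : 3 ≤ L)
  {𝔸 : Type*} [CStarAlgebra 𝔸] [Nontrivial 𝔸]
  {W : Type} [NormedAddCommGroup W] [InnerProductSpace ℂ W] [FiniteDimensional ℂ W] (φ : W ≃ₗ[ℂ] 𝔸)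
  {Mφ Mφ' : ℝ} (hMφ : 0 ≤ Mφ) (hMφ' : 0 ≤ Mφ') (hφ : ∀ w, ‖φ w‖ ≤ Mφ * ‖w‖) (hφ' : ∀ X, ‖φ.symm X‖ ≤ Mφ' * ‖X‖)
  {aQ : ℝ} (haQ : 0 < aQ) {aQ' : ℝ} (haQ' : 0 < aQ')
  (τ : 𝔸 →ₗ[ℂ] ℂ) {Cτ : ℝ} (hτ : ∀ X, ‖τ X‖ ≤ Cτ * ‖X‖) (hCτ : 0 ≤ Cτ) {Mτ : ℝ}
  (hτm : ∀ X Y : 𝔸, ‖τ (X * Y)‖ ≤ Mτ * ‖X‖ * ‖Y‖) (hMτ : 0 ≤ Mτ) {ρw : ℝ} (hρw : 0 ≤ ρw)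
  (hτ₁ : ∀ X : 𝔸, τ (star X) = conj (τ X)) (hτ₂ : ∀ X Y : 𝔸, τ (X * Y) = τ (Y * X))
  (hφτ : ∀ X Y : 𝔸, ⟪φ.symm X, φ.symm Y⟫_ℂ = τ (star X * Y))
  (AQ : ℝ) (hAQ16 : 16 * (((4 : ℕ) : ℝ) + 1) * (((4 : ℕ) : ℝ) + 4) * c2' 4 L ≤ AQ)

include hL3 hMφ hMφ' hφ hφ' haQ haQ' hτ hCτ hτm hMτ hρw hτ₁ hτ₂ hφτ hAQ16

variable (ε₀ B₃ a₀ a₁ : ℝ)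

variable {ε₀ B₃ a₀ a₁} in
/-- **★ CRUX K2⁗ `EndpointGivenBR13Sep` (stmt-QuantumFields-20291; the KEY-18 re-key of K2‴ 19911) — THE REGISTERED (D4) STUB `stub_d4AtSlopeCont13 : D4AtSlopeOfD1Record13`'s BODY AT ONE MEMBER `ε₂₉(d₀)` OF NODE 00's COMPATIBLE [15]-KEYED FAMILY
`θ₁₅ᶜ = theta13OfThm1C F N ε₀ ε₂₉ B₃ a₀ a₁`, WITH NODE D SUPPLIED AND THE β-SIDE ROWS PAID, UNDER A DISPLAYED DRIFT FLOOR `hdrift`**: for `0 < ε₀`, `0 ≤ B₃`, `0 < a₀`,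
`0 < a₁`, NE9's structure data and thresholds `(δs, Cs)`, tower weights, cube side `M` ∕ geometry letters ∕ numerics on `q`, a box `γ₀`, channel `(μ, ν)`, (4.4)-radius
`α₂`, residual `c₀`, and `d₀ > 0` with `hdrift : ∀ e, 0 < e → 4e < ε₀ → θ₁₅ᶜ(e).Admissible → ∀ (Lc, Js, Nc), [β⁰(θ₁₅ᶜ(e)) pinned on secondMoment (TbalOf Lc Js ·) 0 1] →
Residue Lc Js Nc 0 1 → d₀ ≤ stepBal Nc Lc` (dag-n26-c g8 p502604's `hd₀` VERBATIM) (every (D1) datum of every admissible member has slope at least `d₀` — the (D1) lane's ∕ N25's sentence in Cesàro form, dag-n26-c g8's `hd₀`; print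
[I] (2.12)–(2.13): `β⁰` does not read the (2.9) threshold), THERE IS `ε₂₉ > 0` with `4ε₂₉ < ε₀`, θ₁₅ᶜ Stage-13 ADMISSIBLE and `ZtUnity` (rows G, Z — p497784 §1c
`exists_eps29_rows_theta13OfThm1C` at `s := d₀`) such that AT THAT MEMBER — from the Stage-12 [B13] family of record at the faithful letters
`{ c₀ with ε₁ := ε₂₉, A₂ := e·576·K₀(64,8)² }` with N10's leaf and the letters law, the leaf kernels with the (1.22) identification at the ₁₃ merged β, the run sequences ∕
laws ∕ `Restr` (NODE O ∕ 00 ∕ A), N3, ANY regularity display ∕ positivity witness, the (4.4) seams from the tower's fine bond fields with holomorphic activities (NODE B), the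
(1.7) data with `hconv` on the explicit flat (4.35) vectors and the read-out (NODE E), `0 < γ₀`, `Valid` and (C-leaf) ALONE — FOR EVERY (D1) DATUM `(Lc, Js, Nc)` pinned on
the member's `β⁰` with `D1Residue.Residue Lc Js Nc 0 1`: `∃ γ₁, 0 < γ₁ ∧ γ₁ ≤ θ₁₅ᶜ.γ ∧ AtSlopeCont (split₁₃ θ₁₅ᶜ) γ₁ (stepBal Nc Lc)` (witness `γ₁ := γ₀`; p492935 clause
(ii) at the slope `stepBal Nc Lc` with `hsmall := (ε₂₉·K_rem,L ≤ d₀).trans (hdrift …)`).  At `N := 2` the text after `∃ ε₂₉ …` is the BODY of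
`K2Skeleton13Sep.D4AtSlopeOfD1Record13` (plan g67 `D67-REV18/K2Skeleton13Sep.lean` f65d6d28302ea0ea, registered on stmt-QuantumFields-20291; = the ‴ `K2Skeleton13` text but for the unused antecedent `hP : θ.Provisos₁₃Sep F 2`) at `θ := θ₁₅ᶜ(ε₂₉)` (binders `(Lc) (_ : NeZero Lc) (Js) (Nc)`, the pin, `D1Residue.Residue Lc Js Nc 0 1`, `∃ γ₀, 0 < γ₀ ∧ γ₀ ≤ θ.γ ∧ AtSlopeCont … γ₀ (stepBal Nc Lc)` VERBATIM; the (D1) antecedents now USED, through `hdrift`), MODULO the displayed NODE O ∕ B ∕ E inputs + N3 + `Valid` +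
(C-leaf): the N1 row and the (D1)∕(D4) seam row are PAID (ε₂₉ chosen after `M, α₂, q.B₃, c₀, d₀` and BEFORE the datum), NODE D is SUPPLIED — the NODE-D-supplied face of
dag-n26-c g8's announced `…N26SlopeOfRecord13` §4, typed independently over p497784 §1c.  A REDUCTION at one member — NOT a proof of the stub; `hdrift` is a
HYPOTHESIS; nothing of Bałaban's objects asserted; NODE D on the MODEL class; (D4) instance 0∕1; K2‴ ∕ K2⁗ NOT proved.
[cite: Balaban1987RG1, Thm 2 p.259, (1.3) p.260, (1.7) p.261, (1.18) p.263, (1.20)-(1.22) p.264, (2.9) p.266, (2.12)-(2.13) p.268, (4.4) p.281, (4.35) p.290, (5.1) p.292; Balaban1988RG2Cluster, Lemma 3 (2.38) p.20 and p.21; Balaban1988Convergent, (2.10) p.256; Balaban1985Variational, Thm 1 p.279, (190) p.308] -/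
theorem exists_eps29_d4AtSlopeOfD1Record13_at_theta13OfThm1C_of_drift_towerFlat (hε : 0 < ε₀) (hB : 0 ≤ B₃) (ha₀ : 0 < a₀) (ha₁ : 0 < a₁) :
    ∃ δs Cs : ℝ, 0 < δs ∧ 0 ≤ Cs ∧
      ∀ -- tower weights per scale `k` (height `k + 1`)
        (η : ℕ → ℝ) (_hηL : ∀ k, η k * (L : ℝ) ^ (k + 1) = 1) (cw₀ cw₁ : ℕ → ℝ) [∀ k, Fact (0 < cw₀ k)] [∀ k, Fact (0 < cw₁ k)]
        (_hw : ∀ k, cw₀ k * ((L : ℝ) ^ (k + 1)) ^ 4 = cw₁ k) (_hρ : ∀ k, |η k| ^ 4 / cw₀ k ≤ ρw)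
        -- cube side, size indices, block-geometry letters, source direction ∕ value, the (190)-record under numerics only
        (M : ℕ) [NeZero M] (I : Type) (_i₀ : I) (η₀ L₀ M₀ Rg : ℕ → ℝ) (Hg : ℕ → Prop) (μ₀ : Fin 4) (w₀ : W)
        (q : Consts190) (δr : ℝ) (_hδr : 0 < δr) (_hσ₀ : 0 < q.σ) (_hcR : B6.c0 δr (q.σ / δr) ^ 4 ≤ q.cR) (_hκB : 1 ≤ q.κB)
        (_hδ15 : q.δ15 ≤ δs) (_hCst : Cs ≤ q.Cst) (_hmw : ‖w₀‖ ≤ q.m) (_hθ1 : q.θ ≤ 1)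
        (γ₀ : ℝ) (μ ν : Fin 4) (α₂ : ℝ) (c₀ : B13.Consts)
        -- THE ONE (D1)-SIDE LETTER: a positive floor `d₀` of the slopes `stepBal Nc Lc` of ALL (D1) data pinned on the record's `β⁰` at EVERY admissible member
        -- (the (D1) lane's ∕ N25's sentence in Cesàro form — [I] (2.12)–(2.13): `β⁰` does not read the (2.9) threshold; dag-n26-c g8 `hd₀`)
        (d₀ : ℝ) (_hd₀ : 0 < d₀)
        (_hdrift : ∀ e : ℝ, 0 < e → 4 * e < ε₀ → (theta13OfThm1C F N ε₀ e B₃ a₀ a₁).Admissible F N →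
          letI := (theta13OfThm1C F N ε₀ e B₃ a₀ a₁).instVβ₁; letI := (theta13OfThm1C F N ε₀ e B₃ a₀ a₁).instVβ₂
          letI := (theta13OfThm1C F N ε₀ e B₃ a₀ a₁).instιβ
          ∀ (Lc : ℕ) (_ : NeZero Lc) (Js : ℕ → JetData 3 Lc) (Nc : ℝ),
            (∀ j, beta0OfMerged (betaMerged F (mergedTermFamilyMatT F N (TcanOfRecord F N)
                (chiFixed29 F N (theta13OfThm1C F N ε₀ e B₃ a₀ a₁).ν (theta13OfThm1C F N ε₀ e B₃ a₀ a₁).ε₂₉)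
                (theta13OfThm1C F N ε₀ e B₃ a₀ a₁).εbg) (theta13OfThm1C F N ε₀ e B₃ a₀ a₁).ρ8 (theta13OfThm1C F N ε₀ e B₃ a₀ a₁).bV) (theta13OfThm1C F N ε₀ e B₃ a₀ a₁).v₀ j =
              B12Beta.secondMoment (TbalOf Lc Js j) 0 1) →
            D1Residue.Residue Lc Js Nc 0 1 →
            d₀ ≤ B12Normalization.stepBal Nc Lc),
      ∃ ε₂₉ : ℝ, 0 < ε₂₉ ∧ 4 * ε₂₉ < ε₀ ∧ (theta13OfThm1C F N ε₀ ε₂₉ B₃ a₀ a₁).Admissible F N ∧ (theta13OfThm1C F N ε₀ ε₂₉ B₃ a₀ a₁).ZtUnity F N ∧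
      ∀ -- AT THAT MEMBER: a Stage-12 [B13] FAMILY of record with the FAITHFUL letters (minimal `A₂`), the box, the leaf kernels with the (1.22) identification
        (lamF : ResidB13Fam₁₂ F N (theta13OfThm1C F N ε₀ ε₂₉ B₃ a₀ a₁).toStage12Params)
        (_hle : γ₀ ≤ (theta13OfThm1C F N ε₀ ε₂₉ B₃ a₀ a₁).γ) (A1 : (k : ℕ) → (Fin (k + 1) → ℝ) → LDom 4 → Pt 4 → ℝ)
        (_hm : letI := (theta13OfThm1C F N ε₀ ε₂₉ B₃ a₀ a₁).instVβ₁; letI := (theta13OfThm1C F N ε₀ ε₂₉ B₃ a₀ a₁).instVβ₂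
          letI := (theta13OfThm1C F N ε₀ ε₂₉ B₃ a₀ a₁).instιβ
          ∀ k (v : Fin (k + 1) → ℝ), v ∈ Box γ₀ k →
            betaMerged F (mergedTermFamilyMatT F N (TcanOfRecord F N)
                (chiFixed29 F N (theta13OfThm1C F N ε₀ ε₂₉ B₃ a₀ a₁).ν (theta13OfThm1C F N ε₀ ε₂₉ B₃ a₀ a₁).ε₂₉)
                (theta13OfThm1C F N ε₀ ε₂₉ B₃ a₀ a₁).εbg) (theta13OfThm1C F N ε₀ ε₂₉ B₃ a₀ a₁).ρ8
                (theta13OfThm1C F N ε₀ ε₂₉ B₃ a₀ a₁).bV k v =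
              beta0OfMerged (betaMerged F (mergedTermFamilyMatT F N (TcanOfRecord F N)
                  (chiFixed29 F N (theta13OfThm1C F N ε₀ ε₂₉ B₃ a₀ a₁).ν (theta13OfThm1C F N ε₀ ε₂₉ B₃ a₀ a₁).ε₂₉)
                  (theta13OfThm1C F N ε₀ ε₂₉ B₃ a₀ a₁).εbg) (theta13OfThm1C F N ε₀ ε₂₉ B₃ a₀ a₁).ρ8
                  (theta13OfThm1C F N ε₀ ε₂₉ B₃ a₀ a₁).bV) (theta13OfThm1C F N ε₀ ε₂₉ B₃ a₀ a₁).v₀ k +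
                B12Beta.secondMoment (fun _ _ => limKernel (A1 k v)) μ ν)
        -- N10's in-edge in the FAMILY currency at every run and the member letters law on the box, at the Stage-12 part (faithful letters of record of the member)
        (_hcF : ∀ P k v, v ∈ Box γ₀ k → (lamF P k v).c = c13OfRecord₁₂ F N (theta13OfThm1C F N ε₀ ε₂₉ B₃ a₀ a₁).toStage12Params { c₀ with ε₁ := ε₂₉, A₂ := Real.exp 1 * 9 * 64 * K₀ 64 8 ^ 2 })
        (_hleafF : ∀ P, B13FamLeafOfRecord₁₂ F N (theta13OfThm1C F N ε₀ ε₂₉ B₃ a₀ a₁).toStage12Params { c₀ with ε₁ := ε₂₉, A₂ := Real.exp 1 * 9 * 64 * K₀ 64 8 ^ 2 } lamF P)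
        -- per (scale, history) IN THE BOX: a RUN SEQUENCE whose members AT THAT HISTORY have growing coarse tori, their laws and restriction sentences
        (Ps : (k : ℕ) → (Fin (k + 1) → ℝ) → ℕ → B12.RunParams)
        (_hn : ∀ k v, v ∈ Box γ₀ k → Tendsto (fun m => (lamF (Ps k v m) k v).n) atTop atTop)
        (_hsp : ∀ k v, v ∈ Box γ₀ k → ∀ m, SpLaw (lamF (Ps k v m) k v))
        (_h213 : ∀ k v, v ∈ Box γ₀ k → ∀ m, Law213 (lamF (Ps k v m) k v))
        (_hR : ∀ k v, v ∈ Box γ₀ k → ∀ m, (lamF (Ps k v m) k v).Restr)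
        -- N3 (N1 and the seam row are PAID by the choice of the member and `hdrift`)
        (_hs : SignsL (c13OfRecord₁₂ F N (theta13OfThm1C F N ε₀ ε₂₉ B₃ a₀ a₁).toStage12Params { c₀ with ε₁ := ε₂₉, A₂ := Real.exp 1 * 9 * 64 * K₀ 64 8 ^ 2 }) α₂ q.B₃)
        -- ANY admissible regularity display and positivity witness of `Δ_{a,k}(1)` per (k, v, m) on the tower over the member's torus
        (αU : (k : ℕ) → (Fin (k + 1) → ℝ) → ℕ → ℕ → ℝ) (hα1 : ∀ k v m j, αU k v m j ≤ 1 / 64)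
        (hαL : ∀ k v m j, 50 * (((4 : ℕ) : ℝ) + 1) * αU k v m j * (L : ℝ) ^ 4 ≤ 1 / 2)
        (hU1 : ∀ k v m (j : ℕ) (z : B7Prop1Explicit.Site 4) (κ : Fin 4),
          perCfg (towerP L (fun _ : Fin 4 => NOfLayers (fun m => lamF (Ps k v m) k v) m * M) (j + 1))
            (UlevOf L (fun _ : Fin 4 => NOfLayers (fun m => lamF (Ps k v m) k v) m * M) (k + 1) (fun _ => (1 : 𝔸ˣ)) j) z κ ∈ U1 𝔸)
        (hreg : ∀ k v m (j : ℕ) (y : TSite 4 (towerP L (fun _ : Fin 4 => NOfLayers (fun m => lamF (Ps k v m) k v) m * M) j)) (κ : Fin 4)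
          (ρ' : Fin 4 → Fin L),
          ‖((Wcx L (perCfg (towerP L (fun _ : Fin 4 => NOfLayers (fun m => lamF (Ps k v m) k v) m * M) (j + 1))
              (UlevOf L (fun _ : Fin 4 => NOfLayers (fun m => lamF (Ps k v m) k v) m * M) (k + 1) (fun _ => (1 : 𝔸ˣ)) j))
              (cornerSite L y) κ (boxVec L ρ') : 𝔸ˣ) : 𝔸) - 1‖ ≤ αU k v m j)
        (hpos : ∀ k v m (u : BondL2K ℂ 4 (towerP L (fun _ : Fin 4 => NOfLayers (fun m => lamF (Ps k v m) k v) m * M) (k + 1)) (cw₀ k) W), u ≠ 0 →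
          0 < RCLike.re ⟪u, laplaceAk L (fun _ : Fin 4 => NOfLayers (fun m => lamF (Ps k v m) k v) m * M) k φ (η k) (fun _ => (1 : 𝔸ˣ)) hL
            (αU k v m) (hα1 k v m) (hU1 k v m) (hreg k v m) τ (c₀ := cw₀ k) (c₁ := cw₁ k) aQ u⟫_ℂ)
        -- the (4.4) seams FROM THE TOWER's FINE BOND FIELDS into the members' spaces p. 15, the members' ACTIVITIES holomorphic along them (on the box)
        (emb : (k : ℕ) → (v : Fin (k + 1) → ℝ) → (m : ℕ) → TDom 4 ((lamF (Ps k v m) k v).n + 1) → (Bond 4 (towerP L (fun _ : Fin 4 => NOfLayers (fun m => lamF (Ps k v m) k v) m * M) (k + 1)) → W) → (lamF (Ps k v m) k v).Φ)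
        (_hemb : ∀ k v, v ∈ Box γ₀ k → ∀ m X, ∀ u ∈ ball (0 : Bond 4 (towerP L (fun _ : Fin 4 => NOfLayers (fun m => lamF (Ps k v m) k v) m * M) (k + 1)) → W) α₂, emb k v m X u ∈ (lamF (Ps k v m) k v).sp2 X)
        (_hH : ∀ k v, v ∈ Box γ₀ k → ∀ m (X Z : TDom 4 ((lamF (Ps k v m) k v).n + 1)), Z.1 ⊆ X.1 →
          DifferentiableOn ℂ (fun u => (lamF (Ps k v m) k v).H Z (emb k v m X u)) (ball 0 α₂))
        -- the (1.7) ∕ test-vector-limit data (on the box), the limit READ ON THE EXPLICIT FLAT TEST VECTORS, and the read-out of the leaf kernels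
        (V : (k : ℕ) → (Fin (k + 1) → ℝ) → LDom 4 → Type) (_instV : ∀ k v Y, NormedAddCommGroup (V k v Y))
        (_instVs : ∀ k v Y, NormedSpace ℂ (V k v Y))
        (Fw : (k : ℕ) → (v : Fin (k + 1) → ℝ) → (Y : LDom 4) → V k v Y → ℂ)
        (_hFd : ∀ k v, v ∈ Box γ₀ k → ∀ Y, ∃ ρ > 0, DifferentiableOn ℂ (Fw k v Y) (ball 0 ρ))
        (r : (k : ℕ) → (v : Fin (k + 1) → ℝ) → (m : ℕ) → (Y : LDom 4) → (Bond 4 (towerP L (fun _ : Fin 4 => NOfLayers (fun m => lamF (Ps k v m) k v) m * M) (k + 1)) → W) →L[ℂ] V k v Y)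
        (_hfac : ∀ k v, v ∈ Box γ₀ k → ∀ Y : LDom 4, ∀ᶠ m in atTop, ∀ u ∈ ball (0 : Bond 4 (towerP L (fun _ : Fin 4 => NOfLayers (fun m => lamF (Ps k v m) k v) m * M) (k + 1)) → W) α₂,
          (lamF (Ps k v m) k v).Ek1 (tproj ((lamF (Ps k v m) k v).n + 1) Y) (emb k v m (tproj ((lamF (Ps k v m) k v).n + 1) Y) u) = Fw k v Y (r k v m Y u))
        (t : (k : ℕ) → (v : Fin (k + 1) → ℝ) → (Y : LDom 4) → Pt 4 → V k v Y)
        (_hconv : ∀ k v, v ∈ Box γ₀ k → ∀ (Y : LDom 4) (x : Pt 4),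
          Tendsto (fun m => r k v m Y
            (fun b : Bond 4 (towerP L (fun _ : Fin 4 => NOfLayers (fun m => lamF (Ps k v m) k v) m * M) (k + 1)) =>
              if tcubeOf (NOfLayers (fun m => lamF (Ps k v m) k v) m) M (fun i => ((blockCoord (L ^ (k + 1)) (fun _ : Fin 4 => NOfLayers (fun m => lamF (Ps k v m) k v) m * M)
                    (siteCast (towerP_eq_fineP_pow L (fun _ : Fin 4 => NOfLayers (fun m => lamF (Ps k v m) k v) m * M) (k + 1)) (bpos b)) i : ℕ) :
                      ZMod (NOfLayers (fun m => lamF (Ps k v m) k v) m * M))) ∈ (tproj ((lamF (Ps k v m) k v).n + 1) Y).1 then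
                ((WL2.linearEquiv ℂ ℂ (fun _ : Bond 4 (towerP L (fun _ : Fin 4 => NOfLayers (fun m => lamF (Ps k v m) k v) m * M) (k + 1)) => cw₀ k) :
                    BondL2K ℂ 4 (towerP L (fun _ : Fin 4 => NOfLayers (fun m => lamF (Ps k v m) k v) m * M) (k + 1)) (cw₀ k) W ≃ₗ[ℂ] (Bond 4 (towerP L (fun _ : Fin 4 => NOfLayers (fun m => lamF (Ps k v m) k v) m * M) (k + 1)) → W))
                  (H1k L (fun _ : Fin 4 => NOfLayers (fun m => lamF (Ps k v m) k v) m * M) k φ (η k) (fun _ => (1 : 𝔸ˣ)) hL (αU k v m) (hα1 k v m)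
                    (hU1 k v m) (hreg k v m) τ (c₀ := cw₀ k) (c₁ := cw₁ k) (hαL k v m) (hpos k v m)
                    ((WL2.linearEquiv ℂ ℂ (fun _ : Bond 4 (fun _ : Fin 4 => NOfLayers (fun m => lamF (Ps k v m) k v) m * M) => cw₁ k) :
                        BondL2K ℂ 4 (fun _ : Fin 4 => NOfLayers (fun m => lamF (Ps k v m) k v) m * M) (cw₁ k) W ≃ₗ[ℂ]
                          (Bond 4 (fun _ : Fin 4 => NOfLayers (fun m => lamF (Ps k v m) k v) m * M) → W)).symm
                      (Pi.single ((fun i => (⟨((proj (((lamF (Ps k v m) k v).n + 1) * M) x) i).val,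
                          ZMod.val_lt ((proj (((lamF (Ps k v m) k v).n + 1) * M) x) i)⟩ : Fin (NOfLayers (fun m => lamF (Ps k v m) k v) m * M))), μ₀) w₀)))) b
              else 0)) atTop (𝓝 (t k v Y x)))
        (_ha : ∀ k v, v ∈ Box γ₀ k → ∀ (Y : LDom 4) (z : Pt 4), A1 k v Y z = (mixedDeriv (Fw k v Y) (t k v Y 0) (t k v Y z)).re)
        -- the box is a positive box, the (190) numerics validity at the letters, (C-leaf) in the (1.7) read-out letters
        (_hγ₀ : 0 < γ₀) (_hq : q.Valid (c13OfRecord₁₂ F N (theta13OfThm1C F N ε₀ ε₂₉ B₃ a₀ a₁).toStage12Params { c₀ with ε₁ := ε₂₉, A₂ := Real.exp 1 * 9 * 64 * K₀ 64 8 ^ 2 }).δ₀)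
        (_hcont : ∀ k (Y : LDom 4) (z : Pt 4),
          ContinuousOn (fun v : Fin (k + 1) → ℝ => (mixedDeriv (Fw k v Y) (t k v Y 0) (t k v Y z)).re) (Box γ₀ k))
        -- EVERY (D1) DATUM OF THE MEMBER, pinned on the record's one-loop numbers (K2‴ stub 1's output at this θ), with its residue
        (Lc : ℕ) (_ : NeZero Lc) (Js : ℕ → JetData 3 Lc) (Nc : ℝ)
        (_hβ : letI := (theta13OfThm1C F N ε₀ ε₂₉ B₃ a₀ a₁).instVβ₁; letI := (theta13OfThm1C F N ε₀ ε₂₉ B₃ a₀ a₁).instVβ₂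
          letI := (theta13OfThm1C F N ε₀ ε₂₉ B₃ a₀ a₁).instιβ
          ∀ j, beta0OfMerged (betaMerged F (mergedTermFamilyMatT F N (TcanOfRecord F N)
              (chiFixed29 F N (theta13OfThm1C F N ε₀ ε₂₉ B₃ a₀ a₁).ν (theta13OfThm1C F N ε₀ ε₂₉ B₃ a₀ a₁).ε₂₉)
              (theta13OfThm1C F N ε₀ ε₂₉ B₃ a₀ a₁).εbg) (theta13OfThm1C F N ε₀ ε₂₉ B₃ a₀ a₁).ρ8 (theta13OfThm1C F N ε₀ ε₂₉ B₃ a₀ a₁).bV) (theta13OfThm1C F N ε₀ ε₂₉ B₃ a₀ a₁).v₀ j =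
            B12Beta.secondMoment (TbalOf Lc Js j) 0 1)
        (_hres : D1Residue.Residue Lc Js Nc 0 1),
      letI := (theta13OfThm1C F N ε₀ ε₂₉ B₃ a₀ a₁).instVβ₁; letI := (theta13OfThm1C F N ε₀ ε₂₉ B₃ a₀ a₁).instVβ₂
      letI := (theta13OfThm1C F N ε₀ ε₂₉ B₃ a₀ a₁).instιβ
      ∃ γ₁ : ℝ, 0 < γ₁ ∧ γ₁ ≤ (theta13OfThm1C F N ε₀ ε₂₉ B₃ a₀ a₁).γ ∧
        AtSlopeCont
          (oneLoopSplit_betaOfMerged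
            (betaMerged F (mergedTermFamilyMatT F N (TcanOfRecord F N)
              (chiFixed29 F N (theta13OfThm1C F N ε₀ ε₂₉ B₃ a₀ a₁).ν (theta13OfThm1C F N ε₀ ε₂₉ B₃ a₀ a₁).ε₂₉)
              (theta13OfThm1C F N ε₀ ε₂₉ B₃ a₀ a₁).εbg) (theta13OfThm1C F N ε₀ ε₂₉ B₃ a₀ a₁).ρ8
              (theta13OfThm1C F N ε₀ ε₂₉ B₃ a₀ a₁).bV)
            (beta0OfMerged (betaMerged F (mergedTermFamilyMatT F N (TcanOfRecord F N)
              (chiFixed29 F N (theta13OfThm1C F N ε₀ ε₂₉ B₃ a₀ a₁).ν (theta13OfThm1C F N ε₀ ε₂₉ B₃ a₀ a₁).ε₂₉)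
              (theta13OfThm1C F N ε₀ ε₂₉ B₃ a₀ a₁).εbg) (theta13OfThm1C F N ε₀ ε₂₉ B₃ a₀ a₁).ρ8
              (theta13OfThm1C F N ε₀ ε₂₉ B₃ a₀ a₁).bV) (theta13OfThm1C F N ε₀ ε₂₉ B₃ a₀ a₁).v₀)
            (theta13OfThm1C F N ε₀ ε₂₉ B₃ a₀ a₁).γ)
          γ₁ (B12Normalization.stepBal Nc Lc) := by
  obtain ⟨δs, Cs, hδs, hCs, H⟩ :=
    exists_chainTFac190H_betaOfRecord₁₃_of_family_towerFlat F N L hL hL3 φ hMφ hMφ' hφ hφ' haQ haQ' τ hτ hCτ hτm hMτ hρw hτ₁ hτ₂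
      hφτ AQ hAQ16
  refine ⟨δs, Cs, hδs, hCs, ?_⟩
  intro η hηL cw₀ cw₁ _ _ hw hρ M _ I i₀ η₀ L₀ M₀ Rg Hg μ₀ w₀ q δr hδr hσ₀ hcR hκB hδ15 hCst hmw hθ1 γ₀ μ ν α₂ c₀ d₀ hd₀ hdrift
  obtain ⟨ε₂₉, hε0, h4, hAdm, hZt, hC, hseam⟩ := exists_eps29_rows_theta13OfThm1C F N c₀ M α₂ q.B₃ hε hB ha₀ ha₁ hd₀
  refine ⟨ε₂₉, hε0, h4, hAdm, hZt, ?_⟩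
  intro lamF hle A1 hm hcF hleafF Ps hn hsp h213 hR hs αU hα1 hαL hU1 hreg hpos emb hemb hH V instV instVs Fw hFd r hfac t hconv ha
    hγ₀ hq hcont Lc _ Js Nc hβ hres
  exact ⟨γ₀, hγ₀, hle,
    (H η hηL cw₀ cw₁ hw hρ M I i₀ η₀ L₀ M₀ Rg Hg μ₀ w₀ q δr hδr hσ₀ hcR hκB hδ15 hCst hmw hθ1 γ₀ μ ν α₂ (theta13OfThm1C F N ε₀ ε₂₉ B₃ a₀ a₁)
      { c₀ with ε₁ := ε₂₉, A₂ := Real.exp 1 * 9 * 64 * K₀ 64 8 ^ 2 } lamF hle A1 hm hcF hleafF Ps hn hsp h213 hR hC hs αU hα1 hαL hU1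
      hreg hpos emb hemb hH V instV instVs Fw hFd r hfac t hconv ha).2.1 hq _ (hseam.trans (hdrift ε₂₉ hε0 h4 hAdm Lc inferInstance Js Nc hβ hres))
      hcont⟩

end AtTheta15COfDrift

end Summit.QuantumFields.YangMills.Theorems.BalabanUVNodesN26AtTheta13OfThm1CStubD4OfDriftTowerFlat

end
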